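import Literature.NumberTheory.EllipticCurves.BinaryQuarticLocalSolubility
import Mathlib.LinearAlgebra.Matrix.Block
import HarnessLib

/-!
# The linear action of `M₂(R)` on binary quartic forms: its matrix and its determinant `(det γ)^{10}`

Topic `Literature/NumberTheory/EllipticCurves`; companion of `BinaryQuarticForms.lean` (the
substitution action `(f.subst γ)(x,y) = f((x,y)γ)` on `V_R = R⁵`) and
`BinaryQuarticLocalSolubility.lean` (the coefficient vector `BinaryQuartic.coeffs : V_R → R⁵`).

For Bhargava–Shankar, Ann. of Math. 181 (2015), the measure `dv` on `V_ℝ`, `V_ℂ`, `V_{ℚ_p}` is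
the standard additive measure on `R⁵`; its behaviour under the action of `GL₂` enters the
"Jacobian computation" of Props. 2.7–2.8 (arXiv:1006.1002v2 numbering; used again in Prop. 5.12)
through the fact that **`f ↦ f ∘ γ` is linear of determinant `(det γ)^{10}`** — so that `SL₂`
preserves `dv` and the twisted action `γ · f = (det γ)⁻² (f ∘ γ)` of `GL₂` scales it by
`|det γ|^{10−10} = 1` as well. This file provides that algebra:

* `BinaryQuartic.actionMatrix γ ∈ M₅(R)` — the matrix of `f ↦ f ∘ γ` in the coordinates
  `(a, b, c, d, e)` (`coeffs_subst : coeffs (f ∘ γ) = actionMatrix γ · coeffs f`), a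
  representation: `actionMatrix (γ₁γ₂) = actionMatrix γ₁ · actionMatrix γ₂`, `actionMatrix 1 = 1`;
* `BinaryQuartic.det_actionMatrix` — **`det (actionMatrix γ) = (det γ)^{10}`** over a field
  (Bruhat decomposition into shears, a diagonal matrix and the flip, on each of which the action
  matrix is triangular, diagonal `(t₁⁴, t₁³t₂, …, t₂⁴)` or the order-reversing permutation).

## References

* M. Bhargava, A. Shankar, Ann. of Math. (2) 181 (2015) 191–242, §2.1 (the action of `GL₂(ℝ)` on
  `V_ℝ`), Props. 2.7–2.8 ("a Jacobian computation"). [cite: BhargavaShankarAnnals2015, §2 and Props. 2.7–2.8 (arXiv:1006.1002v2 numbering)]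

## Design

`actionMatrix` is a literal `5 × 5` matrix of polynomials in the entries of `γ` (read off from
`BinaryQuartic.subst`); the determinant is computed over a field by factorisation rather than by
expanding a symbolic `5 × 5` determinant.
-/

noncomputable section

open Matrix

namespace Literature.NumberTheory.EllipticCurves

namespace BinaryQuartic

/-! ## The matrix of `f ↦ f ∘ γ` -/

section CommRing

variable {R : Type*} [CommRing R]

/-- The matrix of the linear map `f ↦ f ∘ γ` of `V_R` in the coordinates `(a, b, c, d, e)`, for
`γ = (p q; r s)`: row `i` lists the coefficients of `a, b, c, d, e` in the `i`-th coefficient of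
`f ∘ γ` (Bhargava–Shankar's action `γ · f(x,y) = f((x,y)γ)`, §2). [cite: BhargavaShankarAnnals2015, §2 p. 8 (the action on V_R)] -/
def actionMatrix (γ : Matrix (Fin 2) (Fin 2) R) : Matrix (Fin 5) (Fin 5) R :=
  let p := γ 0 0; let q := γ 0 1; let r := γ 1 0; let s := γ 1 1
  !![p ^ 4, p ^ 3 * q, p ^ 2 * q ^ 2, p * q ^ 3, q ^ 4;
     4 * p ^ 3 * r, p ^ 3 * s + 3 * p ^ 2 * q * r, 2 * p ^ 2 * q * s + 2 * p * q ^ 2 * r,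
       3 * p * q ^ 2 * s + q ^ 3 * r, 4 * q ^ 3 * s;
     6 * p ^ 2 * r ^ 2, 3 * p ^ 2 * r * s + 3 * p * q * r ^ 2,
       p ^ 2 * s ^ 2 + 4 * p * q * r * s + q ^ 2 * r ^ 2, 3 * p * q * s ^ 2 + 3 * q ^ 2 * r * s,
       6 * q ^ 2 * s ^ 2;
     4 * p * r ^ 3, 3 * p * r ^ 2 * s + q * r ^ 3, 2 * p * r * s ^ 2 + 2 * q * r ^ 2 * s,
       p * s ^ 3 + 3 * q * r * s ^ 2, 4 * q * s ^ 3;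
     r ^ 4, r ^ 3 * s, r ^ 2 * s ^ 2, r * s ^ 3, s ^ 4]

/-- **`f ↦ f ∘ γ` is linear with matrix `actionMatrix γ`**: `coeffs (f ∘ γ) = actionMatrix γ · coeffs f`. [cite: BhargavaShankarAnnals2015, §2 p. 8 (the action on V_R)] -/
theorem coeffs_subst (f : BinaryQuartic R) (γ : Matrix (Fin 2) (Fin 2) R) :
    (f.subst γ).coeffs = actionMatrix γ *ᵥ f.coeffs := by
  ext i
  fin_cases i <;> simp [coeffs, actionMatrix, subst, Matrix.mulVec, dotProduct, Fin.sum_univ_five] <;> ring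

/-- The action matrix is a representation: `actionMatrix (γ₁γ₂) = actionMatrix γ₁ · actionMatrix γ₂`
(the substitution action is a left action, `BinaryQuartic.subst_mul`). [folklore] -/
theorem actionMatrix_mul (γ₁ γ₂ : Matrix (Fin 2) (Fin 2) R) :
    actionMatrix (γ₁ * γ₂) = actionMatrix γ₁ * actionMatrix γ₂ := by
  ext i j
  fin_cases i <;> fin_cases j <;>
    simp [actionMatrix, Matrix.mul_apply, Fin.sum_univ_five, Matrix.mul_apply, Fin.sum_univ_two] <;> ring

/-- `actionMatrix 1 = 1`. [folklore] -/
@[simp] theorem actionMatrix_one : actionMatrix (1 : Matrix (Fin 2) (Fin 2) R) = 1 := by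
  ext i j
  fin_cases i <;> fin_cases j <;> simp [actionMatrix]

/-- The action matrix of an upper shear `(1 u; 0 1)` is upper triangular with unit diagonal, so has
determinant `1`. [folklore] -/
theorem det_actionMatrix_upperShear (u : R) : (actionMatrix !![1, u; 0, 1]).det = 1 := by
  have h : (actionMatrix (!![1, u; 0, 1] : Matrix (Fin 2) (Fin 2) R)).BlockTriangular id := by
    intro i j hij
    fin_cases i <;> fin_cases j <;> simp at hij <;> simp [actionMatrix]
  rw [Matrix.det_of_upperTriangular h, Fin.prod_univ_five]
  simp [actionMatrix]

/-- The action matrix of a lower shear `(1 0; l 1)` is lower triangular with unit diagonal, so has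
determinant `1`. [folklore] -/
theorem det_actionMatrix_lowerShear (l : R) : (actionMatrix !![1, 0; l, 1]).det = 1 := by
  have h : (actionMatrix (!![1, 0; l, 1] : Matrix (Fin 2) (Fin 2) R))ᵀ.BlockTriangular id := by
    intro i j hij
    fin_cases i <;> fin_cases j <;> simp at hij <;> simp [actionMatrix, Matrix.transpose_apply]
  rw [← Matrix.det_transpose, Matrix.det_of_upperTriangular h, Fin.prod_univ_five]
  simp [actionMatrix]

/-- The action matrix of `diag(t₁, t₂)` is `diag(t₁⁴, t₁³t₂, t₁²t₂², t₁t₂³, t₂⁴)`, of determinant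
`(t₁t₂)^{10}`. [folklore] -/
theorem det_actionMatrix_diagonal (t₁ t₂ : R) :
    (actionMatrix !![t₁, 0; 0, t₂]).det = (t₁ * t₂) ^ 10 := by
  have h : (actionMatrix (!![t₁, 0; 0, t₂] : Matrix (Fin 2) (Fin 2) R)).BlockTriangular id := by
    intro i j hij
    fin_cases i <;> fin_cases j <;> simp at hij <;> simp [actionMatrix]
  rw [Matrix.det_of_upperTriangular h, Fin.prod_univ_five]
  simp [actionMatrix]
  ring

/-- A matrix with a vanishing first column acts with vanishing first column. [folklore] -/
theorem det_actionMatrix_of_col_zero {γ : Matrix (Fin 2) (Fin 2) R} (h0 : γ 0 0 = 0) (h1 : γ 1 0 = 0) :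
    (actionMatrix γ).det = 0 := by
  refine Matrix.det_eq_zero_of_column_eq_zero 0 fun i ↦ ?_
  fin_cases i <;> simp [actionMatrix, h0, h1]

end CommRing

/-! ## The determinant over a field -/

section Field

variable {K : Type*} [Field K]

/-- Bruhat factorisation when the `(0,0)` entry is nonzero:
`γ = (1 0; r/p 1)(p 0; 0 det γ/p)(1 q/p; 0 1)`. [folklore] -/
theorem eq_lower_mul_diagonal_mul_upper {γ : Matrix (Fin 2) (Fin 2) K} (hp : γ 0 0 ≠ 0) :
    γ = !![1, 0; γ 1 0 / γ 0 0, 1] * !![γ 0 0, 0; 0, γ.det / γ 0 0] * !![1, γ 0 1 / γ 0 0; 0, 1] := by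
  ext i j
  fin_cases i <;> fin_cases j <;>
    simp only [Matrix.mul_apply, Fin.sum_univ_two, Matrix.det_fin_two, Matrix.of_apply,
      Matrix.cons_val', Matrix.cons_val_zero, Matrix.cons_val_one, Matrix.cons_val_fin_one,
      Matrix.empty_val', Fin.isValue, Fin.zero_eta, Fin.mk_one] <;>
    field_simp <;> ring

/-- `det (actionMatrix γ) = (det γ)^{10}` when `γ₀₀ ≠ 0`. [folklore] -/
theorem det_actionMatrix_of_apply_ne_zero {γ : Matrix (Fin 2) (Fin 2) K} (hp : γ 0 0 ≠ 0) :
    (actionMatrix γ).det = γ.det ^ 10 := by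
  conv_lhs => rw [eq_lower_mul_diagonal_mul_upper hp]
  rw [actionMatrix_mul, actionMatrix_mul, Matrix.det_mul, Matrix.det_mul,
    det_actionMatrix_lowerShear, det_actionMatrix_diagonal, det_actionMatrix_upperShear,
    one_mul, mul_one, mul_div_cancel₀ _ hp]

/-- **The linear map `f ↦ f ∘ γ` of `V_K` has determinant `(det γ)^{10}`**; in particular `SL₂(K)`
acts on `V_K = K⁵` by transformations of determinant `1` (so preserves the additive Haar measure
`dv` for `K = ℝ, ℂ, ℚ_p`), and the twisted action `(det γ)⁻² (f ∘ γ)` of `GL₂(K)` has determinant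
`(det γ)^{10} · (det γ)^{−10} = 1` as well. [cite: BhargavaShankarAnnals2015, §2 and Props. 2.7–2.8 (arXiv:1006.1002v2 numbering)] -/
theorem det_actionMatrix (γ : Matrix (Fin 2) (Fin 2) K) : (actionMatrix γ).det = γ.det ^ 10 := by
  by_cases hp : γ 0 0 = 0
  · by_cases hr : γ 1 0 = 0
    · rw [det_actionMatrix_of_col_zero hp hr, Matrix.det_fin_two, hp, hr]
      ring
    · -- `γ = (1 1; 0 1) · M` with `M₀₀ = γ₀₀ − γ₁₀ ≠ 0`
      set M : Matrix (Fin 2) (Fin 2) K := !![1, -1; 0, 1] * γ with hM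
      have hU : (!![1, 1; 0, 1] : Matrix (Fin 2) (Fin 2) K) * !![1, -1; 0, 1] = 1 := by
        ext i j; fin_cases i <;> fin_cases j <;> simp [Matrix.mul_apply, Fin.sum_univ_two]
      have hγ : γ = !![1, 1; 0, 1] * M := by
        rw [hM, ← Matrix.mul_assoc, hU, Matrix.one_mul]
      have hM00 : M 0 0 = γ 0 0 - γ 1 0 := by
        rw [hM, Matrix.mul_apply, Fin.sum_univ_two]
        simp
        ring
      have hM00' : M 0 0 ≠ 0 := by
        rw [hM00, hp, zero_sub]; exact neg_ne_zero.mpr hr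
      have hdetM : M.det = γ.det := by
        rw [hM, Matrix.det_mul, Matrix.det_fin_two_of]; ring
      calc (actionMatrix γ).det = (actionMatrix (!![1, 1; 0, 1] * M)).det := by rw [← hγ]
        _ = M.det ^ 10 := by
          rw [actionMatrix_mul, Matrix.det_mul, det_actionMatrix_upperShear, one_mul,
            det_actionMatrix_of_apply_ne_zero hM00']
        _ = γ.det ^ 10 := by rw [hdetM]
  · exact det_actionMatrix_of_apply_ne_zero hp

/-- The twisted action `γ · f = (det γ)⁻² (f ∘ γ)` of `GL₂(K)` is unimodular on `V_K`: its matrix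
`(det γ)⁻² · actionMatrix γ` has determinant `1`. [cite: BhargavaShankarAnnals2015, §3.3 p. 15 (twisted action; arXiv:1006.1002v2 numbering)] -/
theorem det_smul_actionMatrix {γ : Matrix (Fin 2) (Fin 2) K} (hγ : γ.det ≠ 0) :
    ((γ.det ^ 2)⁻¹ • actionMatrix γ).det = 1 := by
  rw [Matrix.det_smul, det_actionMatrix, Fintype.card_fin]
  field_simp

end Field


end BinaryQuartic

end Literature.NumberTheory.EllipticCurves

end
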